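import Summits.QuantumAdvantage.AdviceFreeQNC0.MassInequalityRegimes
import HarnessLib

/-!
# Cell qa-qnc0 (rung F-Q1, density axis): PAIR DOMINATION PAYS and ONE-WORD DECODING — proofs for
# `MassInequalityRegimes.lean` (planner qa-qnc0-p1 ROUND-12 §2.10 (xi-t), (xi-v′))

* **`pairDomPays : ∀ m, PairDomPays m`, `pairDomPaysK : ∀ m, PairDomPaysK m`** — if every inside row of a
  column-codeword deviation is the XOR of two outside rows, the outside rows used being pairwise distinct, then
  subadditivity of the distance to the (xor-closed) code (`distTo_xor_le` of `MassInequalityK.lean`;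
  `distC m = distTo (IsElim1 m)` definitionally) and the injection `Z ⊔ Z ↪ Z^c` (`sum_inside_le_of_pairCover`)
  give `Σ_in ≤ Σ_out`: a non-negative bracket WHATEVER THE ROW WEIGHTS — the third proved regime of MI.
* **`oneWordDecode : ∀ m, OneWordDecode m`** — a row supported inside a minimum-weight word `c` is at distance
  `min (pwt r) (pwt c − pwt r)` from the code: the nearest codeword is `0` or `c`; every other codeword `Q` has
  `|Q ∖ supp c| ≥ |Q ∩ supp c|` because `Q ⊕ c` is a non-zero codeword, hence `pdist r Q ≥ pwt r`
  (`pwt_le_pdist_of_supp`, pure counting).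

WHAT THIS IS NOT: `OneWordMIAt 8`, MI and MULT₁ stay OPEN; nothing on crux α; separation NOT moved.
-/

namespace Summit.QuantumAdvantage.AdviceFreeQNC0

open Finset

namespace MassInequality

/-! ### Pair domination pays (ROUND-12 §2.10 (xi-t)) — PROOFS -/

section PairDominationProofs

variable {m : ℕ}

/-- `distC m` is `distTo (IsElim1 m)` (definitionally). -/
theorem distC_eq_distTo (r : (Fin m → Bool) → Bool) : distC m r = distTo (IsElim1 m) r := rfl

/-- **`distC` is subadditive under `xor`** (the one-block code contains `0` and is closed under `xor`). -/
theorem distC_xor_le (x y : (Fin m → Bool) → Bool) :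
    distC m (fun v => xor (x v) (y v)) ≤ distC m x + distC m y :=
  distTo_xor_le ⟨_, isElim1_false m⟩ (fun _ _ hQ hQ' => isElim1_xor hQ hQ') x y

/-- The combinatorial core of pair domination: rows `row u : β`, a subadditive cost `f` w.r.t. a binary operation
`xr`, and a disjoint pair cover of the inside rows by outside rows give `Σ_inside f ≤ Σ_outside f`. -/
theorem sum_inside_le_of_pairCover {β : Type*} (K0 : (Fin m → Bool) → Bool) (row : (Fin m → Bool) → β)
    (f : β → ℕ) (xr : β → β → β) (hsub : ∀ x y, f (xr x y) ≤ f x + f y)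
    (p q : (Fin m → Bool) → (Fin m → Bool))
    (hcov : ∀ z, K0 z = false → K0 (p z) = true ∧ K0 (q z) = true ∧ p z ≠ q z ∧ row z = xr (row (p z)) (row (q z)))
    (hdisj : ∀ z z', K0 z = false → K0 z' = false → z ≠ z' →
        p z ≠ p z' ∧ p z ≠ q z' ∧ q z ≠ p z' ∧ q z ≠ q z') :
    ∑ z ∈ univ.filter (fun u : Fin m → Bool => K0 u = false), (f (row z) : ℤ) ≤
      ∑ u ∈ univ.filter (fun u : Fin m → Bool => K0 u = true), (f (row u) : ℤ) := by
  classical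
  set Zs := (univ.filter fun u : Fin m → Bool => K0 u = false) with hZs
  set Os := (univ.filter fun u : Fin m → Bool => K0 u = true) with hOs
  have hmemZ : ∀ {z}, z ∈ Zs → K0 z = false := fun hz => (mem_filter.1 hz).2
  -- (1) row-wise subadditivity on the inside rows
  have h1 : ∑ z ∈ Zs, (f (row z) : ℤ) ≤ ∑ z ∈ Zs, ((f (row (p z)) : ℤ) + (f (row (q z)) : ℤ)) := by
    refine sum_le_sum fun z hz => ?_
    rw [(hcov z (hmemZ hz)).2.2.2]
    exact_mod_cast hsub (row (p z)) (row (q z))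
  -- (2) the cover maps are injective on `Z` with disjoint images inside `Z^c`
  have hpinj : Set.InjOn p ↑Zs := by
    intro z hz z' hz' h
    by_contra hne
    exact (hdisj z z' (hmemZ (mem_coe.1 hz)) (hmemZ (mem_coe.1 hz')) hne).1 h
  have hqinj : Set.InjOn q ↑Zs := by
    intro z hz z' hz' h
    by_contra hne
    exact (hdisj z z' (hmemZ (mem_coe.1 hz)) (hmemZ (mem_coe.1 hz')) hne).2.2.2 h
  have hdis : Disjoint (Zs.image p) (Zs.image q) := by
    rw [disjoint_left]
    intro u hu hu'
    obtain ⟨z, hz, rfl⟩ := mem_image.1 hu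
    obtain ⟨z', hz', h⟩ := mem_image.1 hu'
    by_cases hzz : z = z'
    · subst hzz
      exact (hcov z (hmemZ hz)).2.2.1 h.symm
    · exact (hdisj z z' (hmemZ hz) (hmemZ hz') hzz).2.1 h.symm
  have hsub' : Zs.image p ∪ Zs.image q ⊆ Os := by
    intro u hu
    rcases mem_union.1 hu with hu | hu
    · obtain ⟨z, hz, rfl⟩ := mem_image.1 hu
      exact mem_filter.2 ⟨mem_univ _, (hcov z (hmemZ hz)).1⟩
    · obtain ⟨z, hz, rfl⟩ := mem_image.1 hu
      exact mem_filter.2 ⟨mem_univ _, (hcov z (hmemZ hz)).2.1⟩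
  -- (3) assemble
  calc ∑ z ∈ Zs, (f (row z) : ℤ)
      ≤ ∑ z ∈ Zs, ((f (row (p z)) : ℤ) + (f (row (q z)) : ℤ)) := h1
    _ = ∑ u ∈ Zs.image p ∪ Zs.image q, (f (row u) : ℤ) := by
        rw [sum_union hdis, sum_add_distrib, sum_image hpinj, sum_image hqinj]
    _ ≤ ∑ u ∈ Os, (f (row u) : ℤ) :=
        sum_le_sum_of_subset_of_nonneg hsub' fun _ _ _ => by positivity

/-- **`PairDomPays m`** for every `m` (ROUND-12 §2.10 (xi-t)): a disjoint pair cover of the inside rows by outside rows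
forces `0 ≤ bracket m K0 D`, whatever the row weights. -/
theorem pairDomPays (m : ℕ) : PairDomPays m := by
  rintro K0 D ⟨p, q, hcov, hdisj⟩
  unfold bracket
  rw [sub_nonneg]
  refine sum_inside_le_of_pairCover K0 D (distC m) (fun x y => fun v => xor (x v) (y v)) distC_xor_le p q
    (fun z hz => ?_) hdisj
  obtain ⟨hp, hq, hpq, hD⟩ := hcov z hz
  exact ⟨hp, hq, hpq, funext hD⟩

/-- **`PairDomPaysK m`** for every `m`: the same at level `k+1`, against the `k`-block sum code (which contains `0`,
`sumCode_false`, and is closed under `xor`, `TensorLP.sumCodeWin_xor`). -/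
theorem pairDomPaysK (m : ℕ) : PairDomPaysK m := by
  rintro K0 k D _ ⟨p, q, hcov, hdisj⟩
  unfold bracketK
  rw [sub_nonneg]
  have hsub : ∀ x y : (Fin (m * k) → Bool) → Bool,
      distTo (SumCodeWin (m * k) k 1) (fun v => xor (x v) (y v)) ≤
        distTo (SumCodeWin (m * k) k 1) x + distTo (SumCodeWin (m * k) k 1) y :=
    distTo_xor_le ⟨_, sumCode_false m k⟩ (fun _ _ hQ hQ' => TensorLP.sumCodeWin_xor hQ hQ')
  refine sum_inside_le_of_pairCover K0 D (distTo (SumCodeWin (m * k) k 1)) (fun x y => fun v => xor (x v) (y v))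
    hsub p q (fun z hz => ?_) hdisj
  obtain ⟨hp, hq, hpq, hD⟩ := hcov z hz
  exact ⟨hp, hq, hpq, funext hD⟩

end PairDominationProofs

/-! ### Exact decoding inside one minimum word (ROUND-12 (xi-v′)) — PROOF of `OneWordDecode` -/

section OneWordDecodeProof

variable {m : ℕ}

/-- Indicator form of `pwt`. -/
theorem pwt_eq_sum (X : (Fin m → Bool) → Bool) :
    pwt X = ∑ u : Fin m → Bool, (if X u = true then 1 else 0) := by
  unfold pwt; rw [Finset.card_filter]

/-- Indicator form of `pdist`. -/
theorem pdist_eq_sum (X Y : (Fin m → Bool) → Bool) :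
    pdist X Y = ∑ u : Fin m → Bool, (if X u ≠ Y u then 1 else 0) := by
  unfold pdist; rw [Finset.card_filter]

/-- For `r` supported inside `supp c`: `pdist r c + pwt r = pwt c`. -/
theorem pdist_add_pwt_of_supp {r c : (Fin m → Bool) → Bool} (hr : ∀ v, c v = false → r v = false) :
    pdist r c + pwt r = pwt c := by
  rw [pdist_eq_sum, pwt_eq_sum, pwt_eq_sum, ← Finset.sum_add_distrib]
  refine Finset.sum_congr rfl fun v _ => ?_
  have h := hr v
  revert h
  cases r v <;> cases c v <;> simp

/-- The key estimate: for `r ⊆ supp c` and a codeword-like `Q` with `|Q ∖ supp c| ≥ |Q ∩ supp c|`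
(which holds when `pwt (Q ⊕ c) ≥ pwt c`), `pwt r ≤ pdist r Q`. Pure counting. -/
theorem pwt_le_pdist_of_supp {r c Q : (Fin m → Bool) → Bool} (hr : ∀ v, c v = false → r v = false)
    (hQ : pwt c ≤ pwt (fun v => xor (Q v) (c v))) : pwt r ≤ pdist r Q := by
  -- indicator sums
  have e1 : pdist r Q + 2 * ∑ v : Fin m → Bool, (if r v = true ∧ Q v = true then 1 else 0) =
      ∑ v : Fin m → Bool, (if Q v = true ∧ c v = false then 1 else 0) +
        ∑ v : Fin m → Bool, (if Q v = true ∧ c v = true then 1 else 0) + pwt r := by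
    rw [pdist_eq_sum, pwt_eq_sum, Finset.mul_sum, ← Finset.sum_add_distrib, ← Finset.sum_add_distrib,
      ← Finset.sum_add_distrib]
    refine Finset.sum_congr rfl fun v _ => ?_
    have h := hr v
    revert h
    cases r v <;> cases c v <;> cases Q v <;> simp
  have e2 : pwt (fun v => xor (Q v) (c v)) + ∑ v : Fin m → Bool, (if Q v = true ∧ c v = true then 1 else 0) =
      ∑ v : Fin m → Bool, (if Q v = true ∧ c v = false then 1 else 0) + pwt c := by
    rw [pwt_eq_sum, pwt_eq_sum, ← Finset.sum_add_distrib, ← Finset.sum_add_distrib]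
    refine Finset.sum_congr rfl fun v _ => ?_
    cases c v <;> cases Q v <;> simp
  have e3 : ∑ v : Fin m → Bool, (if r v = true ∧ Q v = true then 1 else 0) ≤ pwt r := by
    rw [pwt_eq_sum]
    exact Finset.sum_le_sum fun v _ => by cases r v <;> cases Q v <;> simp
  have e4 : ∑ v : Fin m → Bool, (if r v = true ∧ Q v = true then 1 else 0) ≤
      ∑ v : Fin m → Bool, (if Q v = true ∧ c v = true then 1 else 0) := by
    refine Finset.sum_le_sum fun v _ => ?_
    have h := hr v
    revert h
    cases r v <;> cases c v <;> cases Q v <;> simp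
  omega

/-- **`OneWordDecode m`** for every `m`: a row supported inside a minimum-weight word `c` is at distance
`min (pwt r) (pwt c − pwt r)` from the code (nearest codeword `0` or `c`; every other codeword `Q` has
`|Q ∖ supp c| ≥ |Q ∩ supp c|` because `Q ⊕ c` is a non-zero codeword, hence `pdist r Q ≥ pwt r`). -/
theorem oneWordDecode (m : ℕ) : OneWordDecode m := by
  intro c hc r hr
  obtain ⟨hcC, hc0, hmin⟩ := hc
  apply le_antisymm
  · -- upper bound: candidates `0` and `c`
    rcases le_total (pwt r) (pwt c - pwt r) with h | h
    · rw [min_eq_left h]; exact distC_le_pwt r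
    · rw [min_eq_right h]
      have := pdist_add_pwt_of_supp hr
      calc distC m r ≤ pdist r c := distC_le hcC
        _ = pwt c - pwt r := by omega
  · -- lower bound over all codewords
    refine le_distC fun Q hQ => ?_
    by_cases hQ0 : pwt Q = 0
    · -- `Q = 0`: the distance is `pwt r`
      have hQf : Q = fun _ => false := by
        funext v
        by_contra hv
        have hv' : Q v = true := by cases hq : Q v <;> simp_all
        have : 0 < pwt Q := by
          unfold pwt
          exact Finset.card_pos.2 ⟨v, Finset.mem_filter.2 ⟨Finset.mem_univ _, hv'⟩⟩
        omega
      subst hQf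
      rw [pdist_false]
      exact min_le_left _ _
    by_cases hQc : pwt (fun v => xor (Q v) (c v)) = 0
    · -- `Q = c`: the distance is `pwt c - pwt r`
      have hQf : Q = c := by
        funext v
        by_contra hv
        have hv' : xor (Q v) (c v) = true := by
          cases hq : Q v <;> cases hc' : c v <;> simp_all
        have : 0 < pwt (fun v => xor (Q v) (c v)) := by
          unfold pwt
          exact Finset.card_pos.2 ⟨v, Finset.mem_filter.2 ⟨Finset.mem_univ _, hv'⟩⟩
        omega
      subst hQf
      have := pdist_add_pwt_of_supp hr
      calc min (pwt r) (pwt Q - pwt r) ≤ pwt Q - pwt r := min_le_right _ _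
        _ = pdist r Q := by omega
    · -- generic `Q`: `Q ⊕ c` is a non-zero codeword, so `pwt c ≤ pwt (Q ⊕ c)`
      have hle : pwt c ≤ pwt (fun v => xor (Q v) (c v)) := hmin _ (isElim1_xor hQ hcC) hQc
      exact (min_le_left _ _).trans (pwt_le_pdist_of_supp hr hle)

end OneWordDecodeProof

end MassInequality

end Summit.QuantumAdvantage.AdviceFreeQNC0
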